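import Summits.QuantumFields.BalabanUV.T4Continuum.Support.GaugeTermScalarData
import Summits.QuantumFields.BalabanUV.T4Continuum.Support.ScalarAveragedCompressionSharp

/-!
# T⁴ programme, spine node NE2 (U1a), tier B row B4.b — THE `U = 1` UNIT DATUM WITH THE POLYNOMIAL-IN-`d` CONSTANT:
# `‖N_{1,k}‖ ≤ σ₁⁻²`, `σ₁ = (d·C₁(d) + a′)⁻¹` (the first link of the σ₀-chain, re-instantiated with «B4c-SIGMA-PLATEAU»'s `sigma1`)

NE2 formalisation swarm `b2b-balaban-t4-ne2-formalise-*`, leaf 05 (gen 8).  Row B4.b's `GaugeTermScalarData.unitDatum_one` (leaf-05 gen 3∕4)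
supplies the `U = 1` unit datum of `perturbationLaws_gaugeTerm` — `K_{1,k} = Q₁G′₁G′₁Q₁ᴴ = Kcomp ⊗ 1` invertible and `‖N_{1,k}‖ ≤ σ₀⁻²` — from
leaf-09's `opNorm_Kcomp_inv_le` with `σ₀ = (36^d(4d + a′))⁻¹`; through `GaugeTermInstance` ∕ `GaugeTermInstanceGeom.kappaGS` ∕ `GaugeTermBalabanData`
∕ `GaugeTermThreshold.KD,KG,KB4` that `σ₀⁻²` reaches ROOT B's explicit threshold `NE2BalabanThreshold.etaStar` to the fourth power.  THIS FILE is the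
sharp twin of that one link: **`unitDatum_one_sharp`** — the same conjunction with `σ₁ = ScalarAveragedCompressionSharp.sigma1 d a′` in place of
`σ₀` (`opNorm_Kcomp_inv_le_sharp`, p235017) — and `inv_sq_sigma1_le` (`σ₁⁻² ≤ σ₀⁻²`: the sharp datum implies the datum of record, which stays
`unitDatum_one` — not restated here).  The rest of the chain (`kappaGS`, `KD`, `KG`, `KB4`, `etaStar` with `σ₁`) is NOT re-instantiated here (offered as
«B4c-SIGMA-THREAD» in `CLAIMS.log`; mechanical).

HONEST FRAMING (T4-DAG p. 1).  [folklore] three-line bookkeeping on landed theorems; constants OURS; MODEL level (`U = 1` scalar layer, finite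
torus); changes NO binder of ROOT B; the tree's `etaStar` is unchanged; NOT [B9] (3.23)–(3.26) as printed; NE2 (U1a) NOT proved; spine 0/9
unchanged; NOT infinite volume / mass gap / Clay / summit progress.  HONEST DEPENDENCY: continuum YM on T⁴ ⇐ BetaPertH ∧ nine spine estimates
(0/9 proved); BetaPertH ⇐ (D1) ∧ (D4) ∧ CAP+tail; G-an2-4 gates asym, D1 and NE2/3/4.  No `sorry`.
-/

noncomputable section

open scoped BigOperators ComplexConjugate Matrix Matrix.Norms.L2Operator Kronecker ComplexOrder

namespace Summit.QuantumFields.BalabanUV.T4Continuum.GaugeTermScalarDataSharp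

open Literature.MathematicalPhysics.QuantumFieldTheory.Balaban1983to89.B5Prop11Plancherel
open Literature.MathematicalPhysics.QuantumFieldTheory.Balaban1983to89.B5G183RateUnitTower (lev lev_neZero)
open Summit.QuantumFields.BalabanUV.T4Continuum
open Summit.QuantumFields.BalabanUV.T4Continuum.KroneckerLift
open Summit.QuantumFields.BalabanUV.T4Continuum.GaugeTermSandwichBound (Nop)
open Summit.QuantumFields.BalabanUV.T4Continuum.GaugeTermLayer
open Summit.QuantumFields.BalabanUV.T4Continuum.GaugeTermPerturbationLaw (oneR)
open Summit.QuantumFields.BalabanUV.T4Continuum.GaugeTermScalarData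
open Summit.QuantumFields.BalabanUV.T4Continuum.ScalarAveragedCompression (sigma0 sigma0_pos)
open Summit.QuantumFields.BalabanUV.T4Continuum.ScalarAveragedCompressionSharp (sigma1 sigma1_pos opNorm_Kcomp_inv_le_sharp sigma0_le_sigma1)

variable {d : ℕ} (L : ℕ) [NeZero L] (M : Fin d → ℕ) [hM : ∀ μ, NeZero (M μ)]
variable {o : Type*} [Fintype o] [DecidableEq o] (a' : ℝ)

/-- **THE `U = 1` UNIT DATUM, SHARP**: every `K_{1,k}` is invertible and `‖N_{1,k}‖ ≤ σ₁⁻²` with `σ₁ = (d·C₁(d) + a′)⁻¹` — `unitDatum_one`'s shape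
with `σ₀ ↦ σ₁` (`ScalarAveragedCompressionSharp.opNorm_Kcomp_inv_le_sharp`). [folklore] -/
theorem unitDatum_one_sharp (ha' : 0 < a') (k : ℕ) :
    IsUnit (Q1 L M o k * Gop L M (oneR L M (o := o)) (Q1 L M o) a' k * Gop L M (oneR L M (o := o)) (Q1 L M o) a' k * (Q1 L M o k)ᴴ).det
      ∧ ‖Nt L M (oneR L M (o := o)) (Q1 L M o) a' k‖ ≤ ((sigma1 d a') ^ 2)⁻¹ := by
  refine ⟨(unitDatum_one L M a' ha' k).1, ?_⟩
  rw [Nt, Nop, gram_one_eq, kron_inv]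
  exact opNorm_kron_le_of_le o (opNorm_Kcomp_inv_le_sharp (lev L k) M ha')

omit hM [Fintype o] [DecidableEq o] in
/-- `σ₁⁻² ≤ σ₀⁻²` (from `sigma0_le_sigma1`): the sharp datum is at least as strong as the datum of record. [folklore] -/
theorem inv_sq_sigma1_le (ha' : 0 < a') : ((sigma1 d a') ^ 2)⁻¹ ≤ ((sigma0 d a') ^ 2)⁻¹ := by
  have h0 := sigma0_pos (d := d) ha'
  have h := sigma0_le_sigma1 (d := d) ha'
  exact inv_anti₀ (pow_pos h0 2) (pow_le_pow_left₀ h0.le h 2)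

end Summit.QuantumFields.BalabanUV.T4Continuum.GaugeTermScalarDataSharp

end
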